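import Summits.ValiantsHypothesis.ValiantsHypothesis.Theorems.BarrierLeverChowHitsPartitionMinorsRStarvedDevice

/-!
# Route BarrierLever — item `ChowHitsPartitionMinorsR` (stmt-ValiantsHypothesis-21882):
# THE MATCHING DESIGN (MD), TYPED — the predicate `IsMDCertifiable`, the conjectures `conjMD` / `conjMDall` (typed, NOT
# asserted), the unconditional arrow, and the residual nodes «… and not MD-certifiable within budget»

Helper file (`--supports stmt-ValiantsHypothesis-21882`; cell valiant-natproofs, rung V4, 𝒟-side support item of route
BarrierLever; prover seat val-np-p5 gen 32; planner RULING R63(b)/(c) and R69(c), STATUS l.1898 / l.1926). Closes NO item.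

THE MATCHING DESIGN (seat memo MEMO-21882-valnp5-g31.md §7; design of record of line `affine_lower`, RULING R63(a)). Identify the
`x`- and `y`-vertex sets with `Fin h`. For a layout `(u, w)` let the ROW DEFECT be the rows that are not columns,
`rowDefect u w = {i // ∀ j, w j ≠ u i}`. Given a RE-MATCHING `φ : rowDefect u w → Fin r` (intended: a bijection onto the column
defect) and weights `lam, s`, the MD design is the `h + #rowDefect` affine forms
`1 + x_a + y_a` (`a : Fin h`) and `1 + lam_i · Σ_{a ∈ u i} x_a + s_i · Σ_{c ∈ w (φ i)} y_c` (`i` in the row defect).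
CONJECTURE MD (numerics, 0 failures: exhaustive `h = 4` (2 590 ordered equal-size lower pairs), 3.0 M of the 3.46 M pairs at
`h = 5`, 222 random pairs `h ≤ 13`, all historically hard pairs; kit j332172, j332324, j332325): for every injective LOWER-SET pair
and EVERY bijective re-matching, generic weights give a non-vanishing partition minor. THEOREM A′ (`ChowStarvedDesign.chowHits_of_starved`,
p727261) is its proved starved case (weights `1`, re-matching = the starved matching).

SEAT FINDING (gen 32, recorded here because it shapes the proof path of R63(d)): the planner's leading-monomial guess K-MD1 — «the
coefficient of the φ-diagonal monomial `∏_U lam_U^{|U|} s_U^{|φU|}` in the MD determinant is a non-zero product of local factors» —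
is FALSE as stated: at `h = 4`, 13 of 936 sampled triples `(R, C, φ)` (all of relabelling type, e.g. `R = ⟨02, 03⟩`, `C = ⟨01, 02⟩`,
`φ : 3 ↦ 1, 03 ↦ 01`) have that coefficient `0` while `det ≠ 0` (8 monomials; work/md of the seat folder). The determinant is
homogeneous for the grading `deg lam = 1, deg s = −1` (degree `‖R‖ − ‖C‖`), nothing more.

This file provides (definitions + bookkeeping; NO conjecture is asserted):
* `rowDefect u w`, the coefficient tables `mdA`, `mdB`, and `IsMDCertifiable u w` := some re-matching `φ` and weights make the MD
  partition matrix nonsingular (the `∃φ` form the node consumes; `φ` is allowed to be any map into `Fin r`, which only weakens the node);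
* `Stmt.conjMD` (every injective lower-set pair is MD-certifiable) and `Stmt.conjMDall` (… for EVERY injective re-matching onto the
  column defect) — `def … : Prop`, typed NOT asserted; `conjMD_of_conjMDall` needs a bijection row defect ≃ column defect and is left
  to the census file;
* the UNCONDITIONAL arrows `chowHits_of_isMDCertifiable` (MD-certifiable ⇒ hit by every `M ≥ h + #rowDefect` forms) and
  `exists_chow_of_isMDCertifiable` (… and `h + #rowDefect + 2h ≤ h·h` ⇒ hit within the lower-set budget);
* node texts `ChowNoStar.Stmt.stub_thickPairsChowRNoMD` / `ChowNoStar.Stmt.stub_thickLowerSetsChowRNoMD` := the v4 texts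
  (`…NoStarved`, p728631) VERBATIM with the further hypothesis «not (MD-certifiable within budget)», the unconditional glue
  `stub_thick{Pairs,LowerSets}ChowRNoStarved_of_noMD`, and the compositions of each node into the item BY NAME.

THE COMPLEMENT («large symmetric difference», `#rowDefect > h·h − 3h`): NOT proved here and, to this seat's knowledge, NOT a
theorem in print or in the tree — it is typed as `Stmt.conjLargeDefect` (NOT asserted). Under `conjMD ∧ conjLargeDefect` the NoMD
lower-set node is vacuous (`stub_thickLowerSetsChowRNoMD_of_conj`), hence the item; both conjuncts are OPEN.

WHAT THIS IS NOT: item 21882 is NOT proved; CONJECTURE MD is NOT proved (only its starved case, THEOREM A′); nothing on crux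
stmt-ValiantsHypothesis-14610 or on `VP` versus `VNP`.
-/

set_option linter.dupNamespace false

open Finset MvPolynomial

noncomputable section

namespace Summit.ValiantsHypothesis.ValiantsHypothesis.Theorems.BarrierLever.ChowMD

variable {h r : ℕ}

/-! ## 1. The matching design -/

/-- **Row defect**: the rows of the layout `(u, w)` that are not columns. -/
abbrev rowDefect (u w : Fin r → Finset (Fin h)) : Type := {i : Fin r // ∀ j, w j ≠ u i}

/-- `x`-coefficient table of the MD design: the vertex form `a` carries `x_a`; the pair form of a defect row `i` carries
`lam_i · Σ_{a ∈ u i} x_a`. -/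
def mdA (u w : Fin r → Finset (Fin h)) (lam : rowDefect u w → ℂ) : (Fin h ⊕ rowDefect u w) → Fin h → ℂ
  | Sum.inl a, a' => if a' = a then 1 else 0
  | Sum.inr i, a' => if a' ∈ u i.1 then lam i else 0

/-- `y`-coefficient table of the MD design: the vertex form `a` carries `y_a`; the pair form of a defect row `i` carries
`s_i · Σ_{c ∈ w (φ i)} y_c`. -/
def mdB (u w : Fin r → Finset (Fin h)) (φ : rowDefect u w → Fin r) (s : rowDefect u w → ℂ) :
    (Fin h ⊕ rowDefect u w) → Fin h → ℂ
  | Sum.inl a, c => if c = a then 1 else 0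
  | Sum.inr i, c => if c ∈ w (φ i) then s i else 0

/-- The MD form of index `k`: `1 + Σ_a A_{k a} x_a + Σ_c B_{k c} y_c`. -/
def mdForm (u w : Fin r → Finset (Fin h)) (φ : rowDefect u w → Fin r) (lam s : rowDefect u w → ℂ)
    (k : Fin h ⊕ rowDefect u w) : MvPolynomial (Fin (h + h)) ℂ :=
  C 1 + ∑ a, C (mdA u w lam k a) * X (Fin.castAdd h a) + ∑ c, C (mdB u w φ s k c) * X (Fin.natAdd h c)

/-- Each MD form is affine. -/
theorem totalDegree_mdForm_le (u w : Fin r → Finset (Fin h)) (φ : rowDefect u w → Fin r)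
    (lam s : rowDefect u w → ℂ) (k : Fin h ⊕ rowDefect u w) : (mdForm u w φ lam s k).totalDegree ≤ 1 :=
  ChowXStar.totalDegree_fullAffine_le _ _ _

/-- The MD partition matrix on the layout `(u, w)`. -/
def mdMatrix (u w : Fin r → Finset (Fin h)) (φ : rowDefect u w → Fin r) (lam s : rowDefect u w → ℂ) :
    Matrix (Fin r) (Fin r) ℂ :=
  Matrix.of fun i j : Fin r => coeff (∑ a ∈ u i, Finsupp.single (Fin.castAdd h a) 1 +
      ∑ c ∈ w j, Finsupp.single (Fin.natAdd h c) 1) (∏ k, mdForm u w φ lam s k)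

/-- **`IsMDCertifiable u w`: the layout is MD-CERTIFIABLE** — some re-matching `φ` of the row defect and some weights
`lam, s` make the MD partition matrix nonsingular. (`φ` may be any map into `Fin r`; the design of record takes a bijection
onto the column defect, cf. `Stmt.conjMDall`.) -/
def IsMDCertifiable (u w : Fin r → Finset (Fin h)) : Prop :=
  ∃ (φ : rowDefect u w → Fin r) (lam s : rowDefect u w → ℂ), (mdMatrix u w φ lam s).det ≠ 0

/-! ## 2. The conjectures, typed (NOT asserted) -/

/-- **CONJECTURE MD (typed, NOT asserted).** Every injective lower-set pair is MD-certifiable. Numerics: 0 failures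
(exhaustive `h = 4`; 3.0 M pairs at `h = 5`; random `h ≤ 13`; all named hard pairs). Its starved case is THEOREM A′. -/
def Stmt.conjMD : Prop :=
  ∀ (h r : ℕ) (u w : Fin r → Finset (Fin h)), Function.Injective u → Function.Injective w →
    IsLowerSet (Set.range u) → IsLowerSet (Set.range w) → IsMDCertifiable u w

/-- **CONJECTURE MD, all re-matchings (typed, NOT asserted).** For every injective lower-set pair and EVERY injective
re-matching of the row defect onto columns outside the rows, some weights make the MD matrix nonsingular (census target of
RULING R63(f): one pair + one `φ` singular for all weights kills this, and kills `conjMD` only if every `φ` fails). -/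
def Stmt.conjMDall : Prop :=
  ∀ (h r : ℕ) (u w : Fin r → Finset (Fin h)), Function.Injective u → Function.Injective w →
    IsLowerSet (Set.range u) → IsLowerSet (Set.range w) →
    ∀ φ : rowDefect u w → Fin r, Function.Injective φ → (∀ i i', u i' ≠ w (φ i)) →
      ∃ lam s : rowDefect u w → ℂ, (mdMatrix u w φ lam s).det ≠ 0

/-- **The large-defect complement (typed, NOT asserted; OPEN).** Injective lower-set pairs whose row defect exceeds the MD
budget (`h·h < h + #rowDefect + 2h`) are hit within the lower-set budget `m + 2h ≤ h·h`. Numerically such pairs (both complexes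
larger than `h·h − 3h`) are hit by `h … 2h` generic forms in every census (`h ≤ 13`), but NO proof is known. -/
def Stmt.conjLargeDefect : Prop :=
  ∃ h₀ : ℕ, ∀ h : ℕ, h₀ ≤ h → ∀ (r : ℕ) (v w' : Fin r → Finset (Fin h)),
    Function.Injective v → Function.Injective w' →
    IsLowerSet (Set.range v) → IsLowerSet (Set.range w') →
    h * h < h + Fintype.card (rowDefect v w') + 2 * h →
    ∃ m : ℕ, m + 2 * h ≤ h * h ∧ ∃ ℓ : Fin m → MvPolynomial (Fin (h + h)) ℂ,
      (∀ k, (ℓ k).totalDegree ≤ 1) ∧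
      (Matrix.of fun i j : Fin r => MvPolynomial.coeff
        (∑ a ∈ v i, Finsupp.single (Fin.castAdd h a) 1 +
          ∑ c ∈ w' j, Finsupp.single (Fin.natAdd h c) 1) (∏ k, ℓ k)).det ≠ 0

/-! ## 3. The arrow -/

/-- **MD ARROW (unconditional).** An MD-certifiable layout is hit by a product of `M` affine forms for every
`M ≥ h + #rowDefect` (the MD forms, re-indexed by `Fin (h + #rowDefect)`, padded with constants). -/
theorem chowHits_of_isMDCertifiable {M : ℕ} (u w : Fin r → Finset (Fin h))
    (hM : h + Fintype.card (rowDefect u w) ≤ M) (hMD : IsMDCertifiable u w) :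
    ∃ ℓ : Fin M → MvPolynomial (Fin (h + h)) ℂ, (∀ k, (ℓ k).totalDegree ≤ 1) ∧
      (Matrix.of fun i j : Fin r => MvPolynomial.coeff (∑ a ∈ u i, Finsupp.single (Fin.castAdd h a) 1 +
          ∑ c ∈ w j, Finsupp.single (Fin.natAdd h c) 1) (∏ k, ℓ k)).det ≠ 0 := by
  classical
  obtain ⟨φ, lam, s, hdet⟩ := hMD
  refine ChowNoStar.chowHits_mono hM u w ?_
  let e : (Fin h ⊕ rowDefect u w) ≃ Fin (h + Fintype.card (rowDefect u w)) :=
    (Fintype.equivFin _).trans (finCongr (by rw [Fintype.card_sum, Fintype.card_fin]))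
  refine ⟨fun k => mdForm u w φ lam s (e.symm k), fun k => totalDegree_mdForm_le u w φ lam s _, ?_⟩
  have hprod : (∏ k, mdForm u w φ lam s (e.symm k)) = ∏ k, mdForm u w φ lam s k :=
    Fintype.prod_equiv e.symm _ _ (fun k => rfl)
  rw [hprod]
  exact hdet

/-- **MD ARROW at the lower-set budget.** If moreover `h + #rowDefect + 2h ≤ h·h`, the layout is hit within budget
`m + 2h ≤ h·h` (take `m = h + #rowDefect`). -/
theorem exists_chow_of_isMDCertifiable (u w : Fin r → Finset (Fin h))
    (hb : h + Fintype.card (rowDefect u w) + 2 * h ≤ h * h) (hMD : IsMDCertifiable u w) :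
    ∃ m : ℕ, m + 2 * h ≤ h * h ∧ ∃ ℓ : Fin m → MvPolynomial (Fin (h + h)) ℂ,
      (∀ k, (ℓ k).totalDegree ≤ 1) ∧
      (Matrix.of fun i j : Fin r => MvPolynomial.coeff
        (∑ a ∈ u i, Finsupp.single (Fin.castAdd h a) 1 +
          ∑ c ∈ w j, Finsupp.single (Fin.natAdd h c) 1) (∏ k, ℓ k)).det ≠ 0 :=
  ⟨h + Fintype.card (rowDefect u w), hb, chowHits_of_isMDCertifiable u w le_rfl hMD⟩

end Summit.ValiantsHypothesis.ValiantsHypothesis.Theorems.BarrierLever.ChowMD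

/-! ## 4. The residual nodes «… and not MD-certifiable within budget» and the unconditional glue -/

namespace Summit.ValiantsHypothesis.ValiantsHypothesis.Theorems.BarrierLever.ChowNoStar

open Summit.ValiantsHypothesis.ValiantsHypothesis.Theorems.BarrierLever.ChowMD
  (rowDefect IsMDCertifiable chowHits_of_isMDCertifiable exists_chow_of_isMDCertifiable)
open Summit.ValiantsHypothesis.ValiantsHypothesis.Theorems.BarrierLever.ChowStarvedDesign (IsStarvedPair)

variable {h r : ℕ}

/-- **NARROWED NODE: THICK PAIRS, not star / bi-star / starved, AND NOT MD-CERTIFIABLE WITHIN BUDGET `h·h`** —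
`Stmt.stub_thickPairsChowRNoStarved` (p728631) VERBATIM with the further hypothesis
`¬ (IsMDCertifiable u w ∧ h + #rowDefect u w ≤ h·h)`. WEAKER, UNCONDITIONALLY (`stub_thickPairsChowRNoStarved_of_noMD`). -/
def Stmt.stub_thickPairsChowRNoMD : Prop :=
  ∃ h₀ : ℕ, ∀ h : ℕ, h₀ ≤ h → ∀ (r : ℕ) (u w : Fin r → Finset (Fin h)),
    Function.Injective u → Function.Injective w →
    h * h < (∑ i, (u i).card) + h → h * h < (∑ j, (w j).card) + h →
    ¬ IsXStarCertifiable u w → ¬ IsXStarCertifiable w u → ¬ IsBiStarCertifiable u w →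
    ¬ Summit.ValiantsHypothesis.ValiantsHypothesis.Theorems.BarrierLever.ChowStarvedDesign.IsStarvedPair u w →
    ¬ Summit.ValiantsHypothesis.ValiantsHypothesis.Theorems.BarrierLever.ChowStarvedDesign.IsStarvedPair w u →
    ¬ (Summit.ValiantsHypothesis.ValiantsHypothesis.Theorems.BarrierLever.ChowMD.IsMDCertifiable u w ∧
        h + Fintype.card (Summit.ValiantsHypothesis.ValiantsHypothesis.Theorems.BarrierLever.ChowMD.rowDefect u w) ≤ h * h) →
    ∃ ℓ : Fin (h * h) → MvPolynomial (Fin (h + h)) ℂ,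
      (∀ k, (ℓ k).totalDegree ≤ 1) ∧
      (Matrix.of fun i j : Fin r => MvPolynomial.coeff
        (∑ a ∈ u i, Finsupp.single (Fin.castAdd h a) 1 +
          ∑ c ∈ w j, Finsupp.single (Fin.natAdd h c) 1) (∏ k, ℓ k)).det ≠ 0

/-- **NARROWED NODE: THICK LOWER-SET PAIRS, not star / bi-star / starved, AND NOT MD-CERTIFIABLE WITHIN BUDGET**
(`m + 2h ≤ h·h`) — `Stmt.stub_thickLowerSetsChowRNoStarved` (p728631) VERBATIM with the further hypothesis
`¬ (IsMDCertifiable v w' ∧ h + #rowDefect v w' + 2h ≤ h·h)`. Under CONJECTURE MD its members all have row defect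
`> h·h − 3h` (the OPEN large-defect regime, `Stmt.conjLargeDefect`). -/
def Stmt.stub_thickLowerSetsChowRNoMD : Prop :=
  ∃ h₀ : ℕ, ∀ h : ℕ, h₀ ≤ h → ∀ (r : ℕ) (v w' : Fin r → Finset (Fin h)),
    Function.Injective v → Function.Injective w' →
    IsLowerSet (Set.range v) → IsLowerSet (Set.range w') →
    h * h < (∑ i, (v i).card) + 2 * h → h * h < (∑ j, (w' j).card) + 2 * h →
    ¬ IsXStarCertifiable v w' → ¬ IsXStarCertifiable w' v → ¬ IsBiStarCertifiable v w' →
    ¬ Summit.ValiantsHypothesis.ValiantsHypothesis.Theorems.BarrierLever.ChowStarvedDesign.IsStarvedPair v w' →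
    ¬ Summit.ValiantsHypothesis.ValiantsHypothesis.Theorems.BarrierLever.ChowStarvedDesign.IsStarvedPair w' v →
    ¬ (Summit.ValiantsHypothesis.ValiantsHypothesis.Theorems.BarrierLever.ChowMD.IsMDCertifiable v w' ∧
        h + Fintype.card (Summit.ValiantsHypothesis.ValiantsHypothesis.Theorems.BarrierLever.ChowMD.rowDefect v w') + 2 * h
          ≤ h * h) →
    ∃ m : ℕ, m + 2 * h ≤ h * h ∧ ∃ ℓ : Fin m → MvPolynomial (Fin (h + h)) ℂ,
      (∀ k, (ℓ k).totalDegree ≤ 1) ∧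
      (Matrix.of fun i j : Fin r => MvPolynomial.coeff
        (∑ a ∈ v i, Finsupp.single (Fin.castAdd h a) 1 +
          ∑ c ∈ w' j, Finsupp.single (Fin.natAdd h c) 1) (∏ k, ℓ k)).det ≠ 0

/-- **GLUE (unconditional): NoMD node ⟹ NoStarved node, thick pairs** — MD-certifiable layouts within budget are hit
by `h·h` forms (`chowHits_of_isMDCertifiable` + padding); no threshold shift. -/
theorem stub_thickPairsChowRNoStarved_of_noMD (hN : Stmt.stub_thickPairsChowRNoMD) :
    Stmt.stub_thickPairsChowRNoStarved := by
  obtain ⟨h₀, hN⟩ := hN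
  refine ⟨h₀, fun h hh r u w hu hw hU hW hX hY hB hS hS' => ?_⟩
  by_cases hMD : IsMDCertifiable u w ∧ h + Fintype.card (rowDefect u w) ≤ h * h
  · exact chowHits_of_isMDCertifiable u w hMD.2 hMD.1
  exact hN h hh r u w hu hw hU hW hX hY hB hS hS' hMD

/-- **GLUE (unconditional): NoMD node ⟹ NoStarved node, thick lower-set pairs** (`exists_chow_of_isMDCertifiable`). -/
theorem stub_thickLowerSetsChowRNoStarved_of_noMD (hN : Stmt.stub_thickLowerSetsChowRNoMD) :
    Stmt.stub_thickLowerSetsChowRNoStarved := by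
  obtain ⟨h₀, hN⟩ := hN
  refine ⟨h₀, fun h hh r v w' hv hw hlv hlw hV hW hX hY hB hS hS' => ?_⟩
  by_cases hMD : IsMDCertifiable v w' ∧ h + Fintype.card (rowDefect v w') + 2 * h ≤ h * h
  · exact exists_chow_of_isMDCertifiable v w' hMD.2 hMD.1
  exact hN h hh r v w' hv hw hlv hlw hV hW hX hY hB hS hS' hMD

/-! ## 5. Compositions into the item, BY NAME -/

/-- **THE ITEM FROM THE NoMD THICK-PAIRS NODE** (glue, then the v4 ⟹ item composition of p728631). -/
theorem chowHitsPartitionMinorsR_of_thickPairsNoMD (hN : Stmt.stub_thickPairsChowRNoMD) :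
    Summit.ValiantsHypothesis.ValiantsHypothesis.Theses.BarrierLever.ChowHitsPartitionMinorsR :=
  chowHitsPartitionMinorsR_of_thickPairsNoStarved (stub_thickPairsChowRNoStarved_of_noMD hN)

/-- **THE ITEM FROM THE NoMD THICK LOWER-SET NODE** (glue, then the v4 ⟹ item composition of p728631). -/
theorem chowHitsPartitionMinorsR_of_thickLowerSetsNoMD (hN : Stmt.stub_thickLowerSetsChowRNoMD) :
    Summit.ValiantsHypothesis.ValiantsHypothesis.Theses.BarrierLever.ChowHitsPartitionMinorsR :=
  chowHitsPartitionMinorsR_of_thickLowerSetsNoStarved (stub_thickLowerSetsChowRNoStarved_of_noMD hN)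

/-- **Under CONJECTURE MD and the large-defect conjecture the NoMD lower-set node is VACUOUS** (hence the item): a member
would be an injective lower-set pair that is not MD-certifiable within budget, i.e. (by `conjMD`) one whose row defect
exceeds the budget — which `conjLargeDefect` hits. Both hypotheses are OPEN; this only records the shape of the closing. -/
theorem stub_thickLowerSetsChowRNoMD_of_conj
    (hMD : Summit.ValiantsHypothesis.ValiantsHypothesis.Theorems.BarrierLever.ChowMD.Stmt.conjMD)
    (hL : Summit.ValiantsHypothesis.ValiantsHypothesis.Theorems.BarrierLever.ChowMD.Stmt.conjLargeDefect) :
    Stmt.stub_thickLowerSetsChowRNoMD := by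
  obtain ⟨h₀, hL⟩ := hL
  refine ⟨h₀, fun h hh r v w' hv hw hlv hlw _ _ _ _ _ _ _ hN => ?_⟩
  have hcert : IsMDCertifiable v w' := hMD h r v w' hv hw hlv hlw
  have hbig : h * h < h + Fintype.card (rowDefect v w') + 2 * h := by
    by_contra hle
    exact hN ⟨hcert, not_lt.mp hle⟩
  exact hL h hh r v w' hv hw hlv hlw hbig

/-- … hence, under the two conjectures, item 21882 (conditional composition; credits nothing). -/
theorem chowHitsPartitionMinorsR_of_conjMD
    (hMD : Summit.ValiantsHypothesis.ValiantsHypothesis.Theorems.BarrierLever.ChowMD.Stmt.conjMD)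
    (hL : Summit.ValiantsHypothesis.ValiantsHypothesis.Theorems.BarrierLever.ChowMD.Stmt.conjLargeDefect) :
    Summit.ValiantsHypothesis.ValiantsHypothesis.Theses.BarrierLever.ChowHitsPartitionMinorsR :=
  chowHitsPartitionMinorsR_of_thickLowerSetsNoMD (stub_thickLowerSetsChowRNoMD_of_conj hMD hL)

/-- sanity (kernel): the item implies the NoMD thick-pairs node (a restriction of the item). -/
theorem stub_thickPairsChowRNoMD_of_item
    (H : Summit.ValiantsHypothesis.ValiantsHypothesis.Theses.BarrierLever.ChowHitsPartitionMinorsR) :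
    Stmt.stub_thickPairsChowRNoMD := by
  obtain ⟨h₀, H⟩ := H
  exact ⟨h₀, fun h hh r u w hu hw _ _ _ _ _ _ _ _ => H h hh r u w hu hw⟩

end Summit.ValiantsHypothesis.ValiantsHypothesis.Theorems.BarrierLever.ChowNoStar

end
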